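import Mathlib

/-!
# Peeling frame: the trivial grading (regular pieces as Bergh–Rydh diagonalizable charts with `A = 0`)

(crux stmt-ResolutionOfSingularities-15640 `WildQuotients.WildQuotientResolution`, S1 = stmt-…-17941; ℤ9
SPECIMEN brick Z6 of res-L1-w45c-idea-2's `cardP_g12/Z9-SPECIMEN.md` §4 (V-BR), companion of
`PeelingFrame.hasResolution_glued_of_pieceGradedCharts_of_berghRydh`: a piece whose ring of invariants
is REGULAR (the Király–Lütkebohmert pieces `P₀`-type / `P₂`) is a diagonalizable chart for the trivial
group `D(0)`. [OURS · L1 W4.5c] — Mathlib-only bookkeeping, NOT a statement of any manuscript.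
Prover res-L1-w45c-stub-1.)

* `exists_trivialGradedAlgebra` — every `k`-algebra `S` carries the trivial grading by `PUnit`
  (`𝒮 _ = ⊤`) as a `GradedAlgebra`, with `𝒮 0 = ⊤` and a ring isomorphism `↥(𝒮 0) ≃+* S` that is the
  identity on underlying elements (so compatibilities with `k`-structures transfer verbatim).
-/

-- single-problem summit: the doubled namespace component `ResolutionOfSingularities` is forced
set_option linter.dupNamespace false

noncomputable section

open DirectSum

namespace Summit.ResolutionOfSingularities.ResolutionOfSingularities.Theorems.WildQuotientResolution.PeelingFrame

/-- **The trivial grading.** For a commutative `k`-algebra `S`, the constant family `𝒮 : PUnit → Submodule k S`,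
`𝒮 _ = ⊤`, is a `GradedAlgebra`; its degree-`0` part is all of `S`, and `↥(𝒮 0) ≃+* S` by the subtype
map. (Used to present a REGULAR ring of invariants as the `D(0)`-chart `Spec (𝒮 0)` of the diagonalizable
Bergh–Rydh fact.) [folklore] -/
theorem exists_trivialGradedAlgebra (k S : Type*) [CommRing k] [CommRing S] [Algebra k S] :
    ∃ (𝒮 : PUnit.{1} → Submodule k S) (_ : GradedAlgebra 𝒮),
      𝒮 0 = ⊤ ∧ ∃ e : ↥(𝒮 0) ≃+* S, ∀ x : ↥(𝒮 0), e x = (x : S) := by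
  classical
  let 𝒮 : PUnit.{1} → Submodule k S := fun _ => ⊤
  haveI : SetLike.GradedMonoid 𝒮 :=
    { one_mem := Submodule.mem_top
      mul_mem := fun _ _ _ _ _ _ => Submodule.mem_top }
  -- the decomposition `S → ⨁ _, 𝒮 _` puts everything in the unique degree
  let dec : S → ⨁ i, ↥(𝒮 i) := fun s => DirectSum.of (fun i => ↥(𝒮 i)) PUnit.unit ⟨s, Submodule.mem_top⟩
  have hcoe_of : ∀ (x : ↥(𝒮 PUnit.unit)),
      (DirectSum.coeAddMonoidHom 𝒮) (DirectSum.of (fun i => ↥(𝒮 i)) PUnit.unit x) = (x : S) :=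
    fun x => DirectSum.coeAddMonoidHom_of 𝒮 PUnit.unit x
  letI : DirectSum.Decomposition 𝒮 :=
    { decompose' := dec
      left_inv := fun s => by
        change (DirectSum.coeAddMonoidHom 𝒮) (dec s) = s
        exact hcoe_of ⟨s, Submodule.mem_top⟩
      right_inv := fun x => by
        change dec ((DirectSum.coeAddMonoidHom 𝒮) x) = x
        induction x using DirectSum.induction_on with
        | zero =>
          rw [map_zero]
          change DirectSum.of (fun i => ↥(𝒮 i)) PUnit.unit ⟨0, _⟩ = 0
          have : (⟨(0 : S), Submodule.mem_top⟩ : ↥(𝒮 PUnit.unit)) = 0 := rfl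
          rw [this, map_zero]
        | of i y =>
          obtain ⟨⟩ := i
          rw [hcoe_of]
        | add x y hx hy =>
          rw [map_add]
          change DirectSum.of (fun i => ↥(𝒮 i)) PUnit.unit ⟨_, _⟩ = _
          have : (⟨(DirectSum.coeAddMonoidHom 𝒮) x + (DirectSum.coeAddMonoidHom 𝒮) y, Submodule.mem_top⟩ :
              ↥(𝒮 PUnit.unit)) =
              ⟨(DirectSum.coeAddMonoidHom 𝒮) x, Submodule.mem_top⟩ +
                ⟨(DirectSum.coeAddMonoidHom 𝒮) y, Submodule.mem_top⟩ := rfl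
          rw [this, map_add]
          exact congrArg₂ (· + ·) hx hy }
  letI : GradedAlgebra 𝒮 := {}
  let e : ↥(𝒮 0) ≃+* S :=
    { toFun := fun x => (x : S)
      invFun := fun s => ⟨s, Submodule.mem_top⟩
      left_inv := fun _ => rfl
      right_inv := fun _ => rfl
      map_mul' := fun _ _ => rfl
      map_add' := fun _ _ => rfl }
  exact ⟨𝒮, inferInstance, rfl, e, fun _ => rfl⟩

end Summit.ResolutionOfSingularities.ResolutionOfSingularities.Theorems.WildQuotientResolution.PeelingFrame

end
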